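import Literature.Analysis.FluidPDE.BilliardTensorMeasure
import Mathlib.MeasureTheory.VectorMeasure.WithDensityVec
import HarnessLib

/-!
# Pairing Serre's billiard tensor measure with matrix test fields

`Literature.Analysis.FluidPDE.BilliardTensorMeasure` constructs D. Serre's mass–momentum tensor
with collitons `M = billiardTensor ε γ a b` as a matrix of signed measures on `ℝ × T^d`. Here its
duality pairing `MatrixMeasure.pairing M G = Σ_{αβ} ∫ G_{αβ} dM_{αβ}` (Mathlib's integral against
a signed measure) with a bounded measurable matrix field `G` is computed in closed form: the
particle part integrates `G(t, x_p(t)) : u_p ⊗ u_p` over the window and each colliton integrates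
`G` along its contact segment against the weight `½ (ε/|Δv|) [Δv] ⊗ [Δv]`. This is the bridge
between the measure `M` and the tested functionals of `BilliardTensorDivFree` /
`BilliardTensorTrace` / `BilliardTensorPositivity` (which are these closed forms for
`G = ∇_{t,y}Ψ`, `G = χ diag(0, 1)`, `G = Q`).

* `signedMeasure_integrable_of_bounded` — a bounded measurable function is integrable against
  any signed measure (finite variation);
* `IsHardSphereTrajectory.integral_particleEntry` — `∫ g d(M^p)_{αβ} = ∫_{[a,b]} g(t, x_p t)
  (u_p)_α (u_p)_β dt` (`VectorMeasure.integral_map` + the tree's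
  `signedMeasure_integral_withDensityᵥ`);
* `integral_collitonSegment` — `∫ g d(segment) = ∫₀¹ g(τ, x + proj(s n)) ds`;
* **`IsHardSphereTrajectory.pairing_billiardTensor`** — the closed form of `⟨M, G⟩`.

## References

* D. Serre, *Compensated integrability on tori; a priori estimate for space-periodic gas flows*,
  C. R. Math. Acad. Sci. Paris 362 (2024) 1425–1444, §5 p. 1438. [Serre2024]
-/

open Set Filter Function MeasureTheory
open scoped InnerProductSpace Topology

namespace Literature.Analysis.FluidPDE

noncomputable section

open Literature.Analysis.FunctionSpaces

section General

variable {Y : Type*} [MeasurableSpace Y]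

/-- A bounded measurable real function is integrable against every signed measure (the variation
of a signed measure is a finite measure, `isFiniteMeasure_variation`). [folklore] -/
theorem signedMeasure_integrable_of_bounded (s : SignedMeasure Y) {f : Y → ℝ} (hf : Measurable f)
    {C : ℝ} (hC : ∀ y, |f y| ≤ C) : s.Integrable f := by
  unfold VectorMeasure.Integrable
  haveI := MatrixMeasure.isFiniteMeasure_variation s
  exact Integrable.of_bound hf.aestronglyMeasurable C (ae_of_all _ fun y => by
    rw [Real.norm_eq_abs]; exact hC y)

end General

variable {d : Type*} [Fintype d] {N : ℕ}

/-- **Integration along a colliton segment**: for bounded measurable `g`,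
`∫ g d(collitonSegment τ x n) = ∫_{s ∈ [0,1]} g(τ, x + proj(s n)) ds`. [folklore] -/
theorem integral_collitonSegment (τ : ℝ) (x : UnitAddTorus d) (n : EuclideanSpace ℝ d)
    {g : ℝ × UnitAddTorus d → ℝ} (hg : Measurable g) {C : ℝ} (hC : ∀ q, |g q| ≤ C) :
    ∫ᵛ q, g q ∂<•(collitonSegment τ x n) =
      ∫ s in Icc (0 : ℝ) 1, g (τ, x + Torus.proj (s • n)) := by
  rw [collitonSegment, VectorMeasure.integral_map (measurable_segmentMap τ x n)
    hg.aestronglyMeasurable]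
  · exact VectorMeasure.integral_toSignedMeasure
  · exact signedMeasure_integrable_of_bounded _ (hg.comp (measurable_segmentMap τ x n)) fun s => hC _

namespace IsHardSphereTrajectory

variable {ε : ℝ} {γ : ℝ → Config N d (UnitAddTorus d)}

/-- **Integration against a particle entry**: for bounded measurable `g`,
`∫ g d(M^p)_{αβ} = ∫_{t ∈ [a,b]} g(t, x_p(t)) (u_p)_α(t) (u_p)_β(t) dt`. [folklore] -/
theorem integral_particleEntry (h : IsHardSphereTrajectory (Torus.geometry d) ε N γ) (a b : ℝ)
    (p : Fin N) (α β : Option d) {g : ℝ × UnitAddTorus d → ℝ} (hg : Measurable g) {C : ℝ}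
    (hC : ∀ q, |g q| ≤ C) :
    ∫ᵛ q, g q ∂<•(particleEntry γ a b p α β) =
      ∫ t in Icc a b, g (graphMap γ p t) * particleDensity γ p α β t := by
  rw [particleEntry, VectorMeasure.integral_map (h.measurable_graphMap p) hg.aestronglyMeasurable]
  · exact MatrixMeasure.signedMeasure_integral_withDensityᵥ (h.integrable_particleDensity p α β a b)
      (hg.comp (h.measurable_graphMap p)).aestronglyMeasurable (C := C) fun t => by
        rw [Real.norm_eq_abs]; exact hC _
  · exact signedMeasure_integrable_of_bounded _ (hg.comp (h.measurable_graphMap p)) fun t => hC _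

/-- **The closed form of `⟨M, G⟩`.** For a matrix field `G` on `ℝ × T^d` with bounded measurable
entries, the pairing of Serre's tensor with collitons over the window is
`Σ_p Σ_{αβ} ∫_{[a,b]} G_{αβ}(t, x_p t) (u_p)_α (u_p)_β dt
 + Σ_{t_c ∈ (a,b]} Σ_{(i,j)} Σ_{αβ} ½ (ε/|Δv_i|) [Δv_i]_α [Δv_i]_β ∫₀¹ G_{αβ}(t_c, x_j + proj(s n_{ij})) ds`.
[cite: Serre2024, §5 p. 1438] -/
theorem pairing_billiardTensor (h : IsHardSphereTrajectory (Torus.geometry d) ε N γ) (a b : ℝ)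
    {G : ℝ × UnitAddTorus d → Matrix (Option d) (Option d) ℝ}
    (hGm : ∀ α β, Measurable fun q => G q α β) {C : ℝ} (hGC : ∀ q α β, |G q α β| ≤ C) :
    (billiardTensor ε γ a b).pairing G =
      (∑ α : Option d, ∑ β : Option d, ∑ p : Fin N,
          ∫ t in Icc a b, G (graphMap γ p t) α β * particleDensity γ p α β t) +
        ∑ α : Option d, ∑ β : Option d, ∑ t ∈ (h.finite_collisionTimes_inter_Ioc a b).toFinset,
          ∑ q ∈ collidingPairs (Torus.geometry d) ε (γ t),
            collitonWeight ε (leftLim γ t) (γ t) q.1 α β *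
              ∫ s in Icc (0 : ℝ) 1,
                G (t, (γ t q.2).1 + Torus.proj (s • (Torus.geometry d).sepVec (γ t q.1).1 (γ t q.2).1)) α β := by
  classical
  rw [MatrixMeasure.pairing, ← Finset.sum_add_distrib]
  refine Finset.sum_congr rfl fun α _ => ?_
  rw [← Finset.sum_add_distrib]
  refine Finset.sum_congr rfl fun β _ => ?_
  have hint : ∀ s : SignedMeasure (ℝ × UnitAddTorus d), s.Integrable fun q => G q α β := fun s =>
    signedMeasure_integrable_of_bounded s (hGm α β) fun q => hGC q α β
  have hentry : billiardTensor ε γ a b α β =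
      (∑ p : Fin N, particleEntry γ a b p α β) +
        ∑ t ∈ (h.finite_collisionTimes_inter_Ioc a b).toFinset, collitonEntryAt ε γ t α β := by
    rw [billiardTensor, Matrix.add_apply, particleTensor, Matrix.of_apply, collitonTensor,
      Matrix.of_apply, finsum_mem_eq_finite_toFinset_sum _ (h.finite_collisionTimes_inter_Ioc a b)]
  rw [hentry, VectorMeasure.integral_add_vectorMeasure (hint _) (hint _),
    VectorMeasure.integral_finsetSum_vectorMeasure (fun p _ => hint _),
    VectorMeasure.integral_finsetSum_vectorMeasure (fun t _ => hint _)]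
  congr 1
  · exact Finset.sum_congr rfl fun p _ => h.integral_particleEntry a b p α β (hGm α β) fun q => hGC q α β
  · refine Finset.sum_congr rfl fun t _ => ?_
    rw [collitonEntryAt, VectorMeasure.integral_finsetSum_vectorMeasure (fun q _ => hint _)]
    refine Finset.sum_congr rfl fun q _ => ?_
    rw [VectorMeasure.integral_smul_vectorMeasure, smul_eq_mul,
      integral_collitonSegment _ _ _ (hGm α β) fun q' => hGC q' α β]

end IsHardSphereTrajectory

end

end Literature.Analysis.FluidPDE
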